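import Summits.HodgeConjecture.HodgeConjecture.Theorems.Ring2WeilCoverageWeilGramLevel32Principal
import Summits.HodgeConjecture.HodgeConjecture.Theorems.Ring2WeilCoverageFullSignatureLevel32
import Summits.HodgeConjecture.HodgeConjecture.Theorems.Ring2WeilCoverageTypeNormSign
import HarnessLib

/-!
# Weil-type family coverage — THE COMPONENT LAW FOR PRINCIPAL-IDEAL TYPES ON `ℤ[ζ₃₂]` (`g = 8`, the all-YES level WITHOUT
# THEOREM L (i)): for EVERY real integer `ϖ₀ ≠ 0` and EVERY skew `ζ′` of type `(ϖ₀)`, `det a(ζ′, s_d) = ±N_{K⁺/ℚ}(ϖ₀)·det a(ξ, s_d)`,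
# and **`= |N_{K⁺/ℚ}(ϖ₀)|·det a(ξ, s_d)` when `ζ′` is `Φ`-positive on a `(4,4)` CM type; EVERY type `(ϖ₀)` occurs (part 61), so every
# `|N(ϖ₀)|` is the component of `ℤ[ζ₃₂]`-CM points of Weil type, on every `K_d`-signature-`(4,4)` CM type**

research route conditional on HC_CM; not a corollary; Q11.4-sentence-2 already refuted in dim ≥ 3.

Ring 2, WEIL-TYPE FAMILY-COVERAGE CENSUS (`HOME/WEIL-FAMILY-COVERAGE.md` `## b01`, block b01.50 (C); owner ring2-b01), part 199 of
the `Ring2WeilCoverage*` series; continues part 158 (`…Level32Principal`: the `θ^i` basis, `det a(ξ, i) = 128`, `det a(ξ, s₂) = 2048`)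
and part 61 (`…FullSignatureLevel32`: every sign pattern is a unit's; every type `(ϖ₀)` occurs); the `32`-analogue of parts
195–198 (`…Level40/48/60/84TypeLaw`, where THEOREM L (i) makes the sign `+` outright).
At `32` THEOREM L (i) FAILS (part 61: `ℚ(ζ₃₂)⁺` has a unit of norm `−1`, e.g. `−1−θ`) and the norm-sign law degenerates:
EVERY principal-ideal type `(ϖ₀)`, `ϖ₀ ∈ ℤ[ζ₃₂]⁺ ∖ 0`, occurs on EVERY CM type (part 61 `exists_type_span_thirtyTwo`).  The
component rule then reads: a skew `ζ′` of type `(ϖ₀)` is `u·ϖ₀ξ`, `u` a real unit of norm `±1`, so `det a(ζ′, s) =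
±N(ϖ₀)·det a(ξ, s)`, and `Φ`-positivity on a `(4,4)` type fixes the sign: `det a = |N_{K⁺/ℚ}(ϖ₀)|·det a(ξ, s)` — class
`[2|N(ϖ₀)|] = [|N(ϖ₀)|]` (`det a(ξ, s_d) = 2^7 d^4`, and `2 ∈ Nm(ℚ(i)ˣ), Nm(ℚ(√−2)ˣ)`).  The smallest non-trivial class: the
prime `π₃₁ = −1 − 2θ + θ²` over `31 ≡ −1 (mod 32)` (inert in `K/K⁺`), `N(π₃₁) = −31`: rows `(4, ℚ(i), 31)`, `(4, ℚ(√−2), 31)`.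

* per `K_d` (`d = 1, 2`): `det_realPart_realMul_xi_<s>` (`det a(ϖ₀ξ, s) = N(ϖ₀)·det a(ξ, s)`, part 82 `det_realPart_mul`),
  **`det_realPart_type_span_<s>_or`** (`= ±N(ϖ₀)·det a(ξ, s)` for every `ζ′` of type `(ϖ₀)`: part 82 `exists_units_eq_mul_of_isOfType`
  + `NumberField.Units.norm`), **`det_realPart_type_span_pos_<s>`** (`= |N(ϖ₀)|·det a(ξ, s)` for `Φ`-positive `ζ′` on a `(4,4)`
  type: part 92 `neg_one_pow_mul_det_realPart_pos`), **`exists_type_span_<s>_det`** (CENSUS FORM: for EVERY `ϖ₀ ≠ 0` and every CM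
  type of `s`-signature `(4,4)` a `Φ`-positive divisor of type `(ϖ₀)` EXISTS — part 61 — and every such has that determinant),
  `mk_mul_det_xi_<s>` (`[N·det a(ξ, s_d)] = [N]`: the class is `[|N(ϖ₀)|]`).

HONEST FRAMING as parts 82–198: kernel statements about traces and norms in `ℚ(ζ₃₂)`, Shimura's divisors of type `(K; Φ; (ϖ₀))`
on `ℂ^Φ/Φ(ℤ[ζ₃₂])` and norm classes; nothing about Hodge classes, `W_K`, general members or HC; `HC_CM` is used nowhere.
No `def`, no named fact, no `sorry`.

References: [cite: vanGeemen1994HodgeAV, Lemma 5.2 (2)–(4), 5.4 and (5.4.1)]; [cite: Shimura1998, §14.3 Prop. 4–5,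
pp. 103–104]; census b01.42 / b01.45 / b01.50 (seat-derived).
-/

noncomputable section

open Polynomial NumberField Module
open scoped nonZeroDivisors

namespace Summit.HodgeConjecture.Ring2WeilCoverage.WeilGramLevel32TypeLaw

open Literature.AlgebraicGeometry.VanGeemen1994 (weilField weilNormResidueGroup)
open Literature.AlgebraicGeometry.Motives (CMType normUnitsSubgroup)
open Literature.NumberTheory.ComplexMultiplication
open Summit.HodgeConjecture.Ring2WeilCoverage.WeilGramTools
open Summit.HodgeConjecture.Ring2WeilCoverage.WeilGramCMPoint
open Summit.HodgeConjecture.Ring2WeilCoverage.RealUnitNormHalfSystems (complexConj_eq_inv)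
open Summit.HodgeConjecture.Ring2WeilCoverage.CyclotomicPrincipalObstruction (complexConj_xi)
open Summit.HodgeConjecture.Ring2WeilCoverage.CyclotomicDifferent (isOfType_one_xi_top xi_ne_zero)
open Summit.HodgeConjecture.HodgeConjecture.Ring2.WeilCoverage (mk_neg_eq_split_of_odd mk_neg_ne_split_of_odd
  mk_eq_split_of_even mk_ne_split_of_even mem_normUnitsSubgroup_of_sq_add_mul_sq natCast_not_mem_normUnitsSubgroup_of_ramified)
open Summit.HodgeConjecture.HodgeConjecture.Ring2.Hypotheses (splitDiscriminantClass)
open Summit.HodgeConjecture.Ring2WeilCoverage.WeilGramLevel32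
open Summit.HodgeConjecture.Ring2WeilCoverage.WeilGramLevel32Principal (exists_basis_thetaPow)
open Summit.HodgeConjecture.Ring2WeilCoverage.WeilGramLevel32SqrtNegOne (det_realPart_xi_sqrtNegOne)
open Summit.HodgeConjecture.Ring2WeilCoverage.WeilGramLevel32SqrtNegTwo (det_realPart_xi_sqrtNegTwo)
open Summit.HodgeConjecture.Ring2WeilCoverage.FullSignatureLevel32 (exists_type_span_thirtyTwo)
open Summit.HodgeConjecture.Ring2WeilCoverage.WeilGramSign (neg_one_pow_mul_det_realPart_pos)
open Summit.HodgeConjecture.Ring2WeilCoverage.TypeNormSign (complexConj_realMul isOfType_realMul algebraMap_ringOfIntegers_ne_zero)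
variable {K : Type} [Field K] [NumberField K] {ζ : K}

/-- the image in `K` of an integer `ϖ₀` of the maximal real subfield (part 55's notation). -/
local notation3 (prettyPrint := false) "𝓇 " x:max => (algebraMap (𝓞 (maximalRealSubfield K)) K x)

/-! ### §1 `K_d = ℚ(i)` (`s = i`): the law `det a(ζ′) = ±N(ϖ₀)·128`, `= |N(ϖ₀)|·128` when `Φ`-positive; census form for EVERY `ϖ₀ ≠ 0` -/

/-- `det a(ϖ₀ξ, i) = N_{K⁺/ℚ}(ϖ₀)·128` for every real integer `ϖ₀` (part 82 `det_realPart_mul` over the principal datum `det a(ξ, i) = 128`,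
part 156). research route conditional on HC_CM; not a corollary; Q11.4-sentence-2 already refuted in dim ≥ 3. [cite: vanGeemen1994HodgeAV, Lemma 5.2 (3)] -/
theorem det_realPart_realMul_xi_sqrtNegOne [IsCyclotomicExtension {32} ℚ K] [IsCMField K] (hζ : IsPrimitiveRoot ζ 32)
    (ϖ₀ : 𝓞 (maximalRealSubfield K))
    {x : Fin 8 → K} (hx : ∀ i, x i = (ζ + ζ⁻¹) ^ (i : ℕ)) {a : Matrix (Fin 8) (Fin 8) ℚ}
    (ha : ∀ i j, a i j = Algebra.trace ℚ K (𝓇 ϖ₀ * (ζ ^ 7 * (aeval ζ (derivative (cyclotomic 32 ℚ)))⁻¹) * x i * IsCMField.complexConj K ((ζ ^ 8) * x j))) :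
    a.det = Algebra.norm ℚ ((ϖ₀ : maximalRealSubfield K)) * 128 := by
  obtain ⟨ωb, hωb⟩ := exists_basis_thetaPow hζ
  have hx' : ∀ i, x i = (ωb i : K) := fun i => (hx i).trans (hωb i).symm
  obtain ⟨γ₀, hγ⟩ := exists_real_eq_mul_of_skew (complexConj_xi_thirtyTwo hζ) (complexConj_sqrtNegOne hζ)
  have e : ((ϖ₀ : maximalRealSubfield K) : K) = 𝓇 ϖ₀ := by
    rw [IsScalarTower.algebraMap_apply (𝓞 (maximalRealSubfield K)) (maximalRealSubfield K) K]
    rfl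
  have hmul := det_realPart_mul ωb (complexConj_sqrtNegOne hζ) hx' hγ (β₀ := (ϖ₀ : maximalRealSubfield K))
    (a := Matrix.of fun i j => Algebra.trace ℚ K ((ζ ^ 7 * (aeval ζ (derivative (cyclotomic 32 ℚ)))⁻¹) * x i * IsCMField.complexConj K ((ζ ^ 8) * x j)))
    (a' := a) (fun i j => rfl) (fun i j => by rw [ha, e])
  have hD := det_realPart_xi_sqrtNegOne hζ hx
    (a := Matrix.of fun i j => Algebra.trace ℚ K ((ζ ^ 7 * (aeval ζ (derivative (cyclotomic 32 ℚ)))⁻¹) * x i * IsCMField.complexConj K ((ζ ^ 8) * x j))) (fun i j => rfl)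
  rw [hD] at hmul
  exact hmul

/-- **THE COMPONENT LAW at `32` for `K_d = ℚ(i)`, up to sign**: for EVERY real integer `ϖ₀ ≠ 0` of `ℚ(ζ_32)⁺` and EVERY skew `ζ′`
of type `(ϖ₀)` on `ℤ[ζ_32]` (`ζ′ = u·ϖ₀ξ`, `u` a real unit, `N(u) = ±1` — BOTH signs occur at `32`, part 61), the Gram
determinant of `(E_ζ′, i)` in the frame `θ^i` is **`±N_{K⁺/ℚ}(ϖ₀)·128`**.
research route conditional on HC_CM; not a corollary; Q11.4-sentence-2 already refuted in dim ≥ 3. [cite: vanGeemen1994HodgeAV, Lemma 5.2 (3)] [cite: Shimura1998, §14.3 Prop. 5, p. 104] -/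
theorem det_realPart_type_span_sqrtNegOne_or [IsCyclotomicExtension {32} ℚ K] [IsCMField K] (hζ : IsPrimitiveRoot ζ 32)
    (ϖ₀ : 𝓞 (maximalRealSubfield K)) (hϖ0 : ϖ₀ ≠ 0)
    {ζ' : K} (hζ' : IsCMField.complexConj K ζ' = -ζ')
    (hT : CMTypeLattice.IsOfType (1 : (FractionalIdeal (𝓞 K)⁰ K)ˣ) ζ' (Ideal.span {ϖ₀}))
    {x : Fin 8 → K} (hx : ∀ i, x i = (ζ + ζ⁻¹) ^ (i : ℕ)) {a : Matrix (Fin 8) (Fin 8) ℚ}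
    (ha : ∀ i j, a i j = Algebra.trace ℚ K (ζ' * x i * IsCMField.complexConj K ((ζ ^ 8) * x j))) :
    a.det = Algebra.norm ℚ ((ϖ₀ : maximalRealSubfield K)) * 128 ∨
      a.det = -(Algebra.norm ℚ ((ϖ₀ : maximalRealSubfield K)) * 128) := by
  obtain ⟨ωb, hωb⟩ := exists_basis_thetaPow hζ
  have hx' : ∀ i, x i = (ωb i : K) := fun i => (hx i).trans (hωb i).symm
  have hξ := complexConj_xi_thirtyTwo hζ
  have hsk := complexConj_realMul ϖ₀ hξ
  have h0 := mul_ne_zero (algebraMap_ringOfIntegers_ne_zero (K := K) hϖ0) (xi_ne_zero hζ 7)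
  have hT₀ : CMTypeLattice.IsOfType (1 : (FractionalIdeal (𝓞 K)⁰ K)ˣ) (𝓇 ϖ₀ * (ζ ^ 7 * (aeval ζ (derivative (cyclotomic 32 ℚ)))⁻¹)) (Ideal.span {ϖ₀}) := by
    have h := isOfType_realMul (𝔪 := 1) ϖ₀ (isOfType_one_xi_top hζ 7)
    rwa [Ideal.mul_top] at h
  obtain ⟨u, hu⟩ := exists_units_eq_mul_of_isOfType hsk h0 hζ' hT₀ hT
  obtain ⟨γ₀, hγ⟩ := exists_real_eq_mul_of_skew hsk (complexConj_sqrtNegOne hζ)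
  have hD := det_realPart_realMul_xi_sqrtNegOne hζ ϖ₀ hx
    (a := Matrix.of fun i j => Algebra.trace ℚ K (𝓇 ϖ₀ * (ζ ^ 7 * (aeval ζ (derivative (cyclotomic 32 ℚ)))⁻¹) * x i * IsCMField.complexConj K ((ζ ^ 8) * x j))) (fun i j => rfl)
  have hmul := det_realPart_mul ωb (complexConj_sqrtNegOne hζ) hx' hγ
    (β₀ := ((u : 𝓞 (maximalRealSubfield K)) : maximalRealSubfield K))
    (a := Matrix.of fun i j => Algebra.trace ℚ K (𝓇 ϖ₀ * (ζ ^ 7 * (aeval ζ (derivative (cyclotomic 32 ℚ)))⁻¹) * x i * IsCMField.complexConj K ((ζ ^ 8) * x j)))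
    (a' := a) (fun i j => rfl) (fun i j => by rw [ha, hu, mul_assoc])
  rw [hD] at hmul
  have hn := NumberField.Units.norm (maximalRealSubfield K) u
  rcases abs_eq (by norm_num : (0 : ℚ) ≤ 1) |>.mp hn with h1 | h1
  · left; rw [hmul, h1]; ring
  · right; rw [hmul, h1]; ring

open scoped Classical in
/-- **THE COMPONENT LAW at `32` for `K_d = ℚ(i)`, SIGN FIXED BY `Φ`-POSITIVITY**: on a CM type `Φ` of `i`-signature `(4,4)`, a
`Φ`-positive skew `ζ′` of type `(ϖ₀)` has `(−1)⁴ det a > 0` (part 92), hence **`det a = |N_{K⁺/ℚ}(ϖ₀)|·128`** — the point lies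
on the class `[|N(ϖ₀)|]` of `ℚˣ/Nm(ℚ(i)ˣ)` (`128 ∈ 2·(ℚˣ)²`, `2 ∈ Nm`).
research route conditional on HC_CM; not a corollary; Q11.4-sentence-2 already refuted in dim ≥ 3. [cite: vanGeemen1994HodgeAV, Lemma 5.2 (3)–(4) and (5.4.1)] [cite: Shimura1998, §14.3 Prop. 4–5, pp. 103–104] -/
theorem det_realPart_type_span_pos_sqrtNegOne [IsCyclotomicExtension {32} ℚ K] [IsCMField K] (hζ : IsPrimitiveRoot ζ 32)
    (Φ : CMType K)
    (hneg : (Finset.univ.filter fun φ : Φ.1 => (φ.1 (ζ ^ 8)).im < 0).card = 4)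
    (hposc : (Finset.univ.filter fun φ : Φ.1 => 0 < (φ.1 (ζ ^ 8)).im).card = 4)
    {ϖ₀ : 𝓞 (maximalRealSubfield K)} (hϖ0 : ϖ₀ ≠ 0)
    {ζ' : K} (hζ' : IsCMField.complexConj K ζ' = -ζ') (hpos : ∀ φ : Φ.1, 0 < (φ.1 ζ').im)
    (hT : CMTypeLattice.IsOfType (1 : (FractionalIdeal (𝓞 K)⁰ K)ˣ) ζ' (Ideal.span {ϖ₀}))
    {x : Fin 8 → K} (hx : ∀ i, x i = (ζ + ζ⁻¹) ^ (i : ℕ)) {a : Matrix (Fin 8) (Fin 8) ℚ}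
    (ha : ∀ i j, a i j = Algebra.trace ℚ K (ζ' * x i * IsCMField.complexConj K ((ζ ^ 8) * x j))) :
    a.det = |Algebra.norm ℚ ((ϖ₀ : maximalRealSubfield K))| * 128 := by
  obtain ⟨ωb, hωb⟩ := exists_basis_thetaPow hζ
  have hx' : ∀ i, x i = (ωb i : K) := fun i => (hx i).trans (hωb i).symm
  have hs := complexConj_sqrtNegOne hζ
  have hs0 : ((ζ ^ 8) : K) ≠ 0 := fun h => by
    have h2 := sq_sqrtNegOne hζ
    rw [h] at h2
    norm_num at h2
  have hζ'0 : ζ' ≠ 0 := by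
    obtain ⟨φ, -⟩ := Finset.card_pos.mp (by rw [hposc]; norm_num :
      0 < (Finset.univ.filter fun φ : Φ.1 => 0 < (φ.1 (ζ ^ 8)).im).card)
    intro h0
    have := hpos φ
    rw [h0, map_zero, Complex.zero_im] at this
    exact lt_irrefl _ this
  obtain ⟨γ₀, hγ⟩ := exists_real_eq_mul_of_skew hζ' hs
  have hsign := neg_one_pow_mul_det_realPart_pos Φ ωb hζ' hs hs0 hζ'0 hpos hneg hposc hx' hγ ha
  have hD0 : (0 : ℚ) < 128 := by norm_num
  rcases det_realPart_type_span_sqrtNegOne_or hζ ϖ₀ hϖ0 hζ' hT hx ha with h | h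
  · rw [h] at hsign ⊢
    have hN : 0 < Algebra.norm ℚ ((ϖ₀ : maximalRealSubfield K)) := by
      by_contra hle
      push Not at hle
      norm_num at hsign
      nlinarith [hsign, hle, hD0]
    rw [abs_of_pos hN]
  · rw [h] at hsign ⊢
    have hN : Algebra.norm ℚ ((ϖ₀ : maximalRealSubfield K)) < 0 := by
      by_contra hle
      push Not at hle
      norm_num at hsign
      nlinarith [hsign, hle, hD0]
    rw [abs_of_neg hN]
    ring

open scoped Classical in
/-- **CENSUS FORM OF THE LAW at `32`** (`K_d = ℚ(i)`): for EVERY real integer `ϖ₀ ≠ 0` of `ℚ(ζ_32)⁺` — either norm sign — and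
every CM type `Φ` of `i`-signature `(4,4)`, `ℂ^Φ/Φ(ℤ[ζ_32])` CARRIES a `Φ`-positive divisor of type `(K; Φ; (ϖ₀))` (part 61
`exists_type_span_thirtyTwo`, no balance hypothesis needed) and EVERY such divisor has Gram determinant `|N(ϖ₀)|·128`:
**every `|N(ϖ₀)|`, `ϖ₀ ∈ ℤ[ζ₃₂]⁺ ∖ 0`, is the component of a `ℤ[ζ₃₂]`-CM point of Weil type.**
research route conditional on HC_CM; not a corollary; Q11.4-sentence-2 already refuted in dim ≥ 3. [cite: vanGeemen1994HodgeAV, Lemma 5.2 (3)–(4) and (5.4.1)] [cite: Shimura1998, §14.3 Prop. 4–5, pp. 103–104] -/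
theorem exists_type_span_sqrtNegOne_det [IsCyclotomicExtension {32} ℚ K] [IsCMField K] (hζ : IsPrimitiveRoot ζ 32)
    (Φ : CMType K)
    (hneg : (Finset.univ.filter fun φ : Φ.1 => (φ.1 (ζ ^ 8)).im < 0).card = 4)
    (hposc : (Finset.univ.filter fun φ : Φ.1 => 0 < (φ.1 (ζ ^ 8)).im).card = 4)
    (ϖ₀ : 𝓞 (maximalRealSubfield K)) (hϖ0 : ϖ₀ ≠ 0) :
    ∃ ζ' : K, IsCMField.complexConj K ζ' = -ζ' ∧ (∀ φ : Φ.1, 0 < (φ.1 ζ').im) ∧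
      CMTypeLattice.IsOfType (1 : (FractionalIdeal (𝓞 K)⁰ K)ˣ) ζ' (Ideal.span {ϖ₀}) ∧
      ∀ (x : Fin 8 → K), (∀ i, x i = (ζ + ζ⁻¹) ^ (i : ℕ)) → ∀ a : Matrix (Fin 8) (Fin 8) ℚ,
        (∀ i j, a i j = Algebra.trace ℚ K (ζ' * x i * IsCMField.complexConj K ((ζ ^ 8) * x j))) →
        a.det = |Algebra.norm ℚ ((ϖ₀ : maximalRealSubfield K))| * 128 := by
  obtain ⟨ζ', h1, h2, h3⟩ := exists_type_span_thirtyTwo hζ Φ hϖ0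
  exact ⟨ζ', h1, h2, h3, fun x hx a ha => det_realPart_type_span_pos_sqrtNegOne hζ Φ hneg hposc hϖ0 h1 h2 h3 hx ha⟩

/-- **`[N·128] = [N]` in `ℚˣ/Nm(ℚ(i)ˣ)`** for every rational `N ≠ 0` (`1/128 = (1 / 16)² + 1·(1 / 16)²`: `128 = 2⁷·1⁴ ∈ 2·(ℚˣ)²` and `2` is a norm
from `ℚ(i)`): the class of a type-`(ϖ₀)` point at `32` is `[|N_{K⁺/ℚ}(ϖ₀)|]`.
research route conditional on HC_CM; not a corollary; Q11.4-sentence-2 already refuted in dim ≥ 3. [cite: vanGeemen1994HodgeAV, 5.4 and (5.4.1)] -/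
theorem mk_mul_det_xi_sqrtNegOne (N : ℚ) (hN : N ≠ 0) :
    (QuotientGroup.mk (Units.mk0 (N * 128) (mul_ne_zero hN (by norm_num))) : weilNormResidueGroup 1) =
      QuotientGroup.mk (Units.mk0 N hN) := by
  rw [QuotientGroup.eq]
  have e : (Units.mk0 (N * 128) (mul_ne_zero hN (by norm_num)))⁻¹ * Units.mk0 N hN =
      Units.mk0 ((1 / 128 : ℚ)) (by norm_num) := by
    ext
    simp only [Units.val_mul, Units.val_inv_eq_inv_val, Units.val_mk0]
    field_simp
  rw [e]
  exact mem_normUnitsSubgroup_of_sq_add_mul_sq _ ((1 / 16) : ℚ) ((1 / 16) : ℚ) (by norm_num)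

/-! ### §2 `K_d = ℚ(√−2)` (`s = s₂`): the law `det a(ζ′) = ±N(ϖ₀)·2048`, `= |N(ϖ₀)|·2048` when `Φ`-positive; census form for EVERY `ϖ₀ ≠ 0` -/

/-- `det a(ϖ₀ξ, s₂) = N_{K⁺/ℚ}(ϖ₀)·2048` for every real integer `ϖ₀` (part 82 `det_realPart_mul` over the principal datum `det a(ξ, s₂) = 2048`,
part 157). research route conditional on HC_CM; not a corollary; Q11.4-sentence-2 already refuted in dim ≥ 3. [cite: vanGeemen1994HodgeAV, Lemma 5.2 (3)] -/
theorem det_realPart_realMul_xi_sqrtNegTwo [IsCyclotomicExtension {32} ℚ K] [IsCMField K] (hζ : IsPrimitiveRoot ζ 32)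
    (ϖ₀ : 𝓞 (maximalRealSubfield K))
    {x : Fin 8 → K} (hx : ∀ i, x i = (ζ + ζ⁻¹) ^ (i : ℕ)) {a : Matrix (Fin 8) (Fin 8) ℚ}
    (ha : ∀ i j, a i j = Algebra.trace ℚ K (𝓇 ϖ₀ * (ζ ^ 7 * (aeval ζ (derivative (cyclotomic 32 ℚ)))⁻¹) * x i * IsCMField.complexConj K ((ζ ^ 4 + ζ ^ 12) * x j))) :
    a.det = Algebra.norm ℚ ((ϖ₀ : maximalRealSubfield K)) * 2048 := by
  obtain ⟨ωb, hωb⟩ := exists_basis_thetaPow hζ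
  have hx' : ∀ i, x i = (ωb i : K) := fun i => (hx i).trans (hωb i).symm
  obtain ⟨γ₀, hγ⟩ := exists_real_eq_mul_of_skew (complexConj_xi_thirtyTwo hζ) (complexConj_sqrtNegTwo hζ)
  have e : ((ϖ₀ : maximalRealSubfield K) : K) = 𝓇 ϖ₀ := by
    rw [IsScalarTower.algebraMap_apply (𝓞 (maximalRealSubfield K)) (maximalRealSubfield K) K]
    rfl
  have hmul := det_realPart_mul ωb (complexConj_sqrtNegTwo hζ) hx' hγ (β₀ := (ϖ₀ : maximalRealSubfield K))
    (a := Matrix.of fun i j => Algebra.trace ℚ K ((ζ ^ 7 * (aeval ζ (derivative (cyclotomic 32 ℚ)))⁻¹) * x i * IsCMField.complexConj K ((ζ ^ 4 + ζ ^ 12) * x j)))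
    (a' := a) (fun i j => rfl) (fun i j => by rw [ha, e])
  have hD := det_realPart_xi_sqrtNegTwo hζ hx
    (a := Matrix.of fun i j => Algebra.trace ℚ K ((ζ ^ 7 * (aeval ζ (derivative (cyclotomic 32 ℚ)))⁻¹) * x i * IsCMField.complexConj K ((ζ ^ 4 + ζ ^ 12) * x j))) (fun i j => rfl)
  rw [hD] at hmul
  exact hmul

/-- **THE COMPONENT LAW at `32` for `K_d = ℚ(√−2)`, up to sign**: for EVERY real integer `ϖ₀ ≠ 0` of `ℚ(ζ_32)⁺` and EVERY skew `ζ′`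
of type `(ϖ₀)` on `ℤ[ζ_32]` (`ζ′ = u·ϖ₀ξ`, `u` a real unit, `N(u) = ±1` — BOTH signs occur at `32`, part 61), the Gram
determinant of `(E_ζ′, s₂)` in the frame `θ^i` is **`±N_{K⁺/ℚ}(ϖ₀)·2048`**.
research route conditional on HC_CM; not a corollary; Q11.4-sentence-2 already refuted in dim ≥ 3. [cite: vanGeemen1994HodgeAV, Lemma 5.2 (3)] [cite: Shimura1998, §14.3 Prop. 5, p. 104] -/
theorem det_realPart_type_span_sqrtNegTwo_or [IsCyclotomicExtension {32} ℚ K] [IsCMField K] (hζ : IsPrimitiveRoot ζ 32)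
    (ϖ₀ : 𝓞 (maximalRealSubfield K)) (hϖ0 : ϖ₀ ≠ 0)
    {ζ' : K} (hζ' : IsCMField.complexConj K ζ' = -ζ')
    (hT : CMTypeLattice.IsOfType (1 : (FractionalIdeal (𝓞 K)⁰ K)ˣ) ζ' (Ideal.span {ϖ₀}))
    {x : Fin 8 → K} (hx : ∀ i, x i = (ζ + ζ⁻¹) ^ (i : ℕ)) {a : Matrix (Fin 8) (Fin 8) ℚ}
    (ha : ∀ i j, a i j = Algebra.trace ℚ K (ζ' * x i * IsCMField.complexConj K ((ζ ^ 4 + ζ ^ 12) * x j))) :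
    a.det = Algebra.norm ℚ ((ϖ₀ : maximalRealSubfield K)) * 2048 ∨
      a.det = -(Algebra.norm ℚ ((ϖ₀ : maximalRealSubfield K)) * 2048) := by
  obtain ⟨ωb, hωb⟩ := exists_basis_thetaPow hζ
  have hx' : ∀ i, x i = (ωb i : K) := fun i => (hx i).trans (hωb i).symm
  have hξ := complexConj_xi_thirtyTwo hζ
  have hsk := complexConj_realMul ϖ₀ hξ
  have h0 := mul_ne_zero (algebraMap_ringOfIntegers_ne_zero (K := K) hϖ0) (xi_ne_zero hζ 7)
  have hT₀ : CMTypeLattice.IsOfType (1 : (FractionalIdeal (𝓞 K)⁰ K)ˣ) (𝓇 ϖ₀ * (ζ ^ 7 * (aeval ζ (derivative (cyclotomic 32 ℚ)))⁻¹)) (Ideal.span {ϖ₀}) := by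
    have h := isOfType_realMul (𝔪 := 1) ϖ₀ (isOfType_one_xi_top hζ 7)
    rwa [Ideal.mul_top] at h
  obtain ⟨u, hu⟩ := exists_units_eq_mul_of_isOfType hsk h0 hζ' hT₀ hT
  obtain ⟨γ₀, hγ⟩ := exists_real_eq_mul_of_skew hsk (complexConj_sqrtNegTwo hζ)
  have hD := det_realPart_realMul_xi_sqrtNegTwo hζ ϖ₀ hx
    (a := Matrix.of fun i j => Algebra.trace ℚ K (𝓇 ϖ₀ * (ζ ^ 7 * (aeval ζ (derivative (cyclotomic 32 ℚ)))⁻¹) * x i * IsCMField.complexConj K ((ζ ^ 4 + ζ ^ 12) * x j))) (fun i j => rfl)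
  have hmul := det_realPart_mul ωb (complexConj_sqrtNegTwo hζ) hx' hγ
    (β₀ := ((u : 𝓞 (maximalRealSubfield K)) : maximalRealSubfield K))
    (a := Matrix.of fun i j => Algebra.trace ℚ K (𝓇 ϖ₀ * (ζ ^ 7 * (aeval ζ (derivative (cyclotomic 32 ℚ)))⁻¹) * x i * IsCMField.complexConj K ((ζ ^ 4 + ζ ^ 12) * x j)))
    (a' := a) (fun i j => rfl) (fun i j => by rw [ha, hu, mul_assoc])
  rw [hD] at hmul
  have hn := NumberField.Units.norm (maximalRealSubfield K) u
  rcases abs_eq (by norm_num : (0 : ℚ) ≤ 1) |>.mp hn with h1 | h1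
  · left; rw [hmul, h1]; ring
  · right; rw [hmul, h1]; ring

open scoped Classical in
/-- **THE COMPONENT LAW at `32` for `K_d = ℚ(√−2)`, SIGN FIXED BY `Φ`-POSITIVITY**: on a CM type `Φ` of `s₂`-signature `(4,4)`, a
`Φ`-positive skew `ζ′` of type `(ϖ₀)` has `(−1)⁴ det a > 0` (part 92), hence **`det a = |N_{K⁺/ℚ}(ϖ₀)|·2048`** — the point lies
on the class `[|N(ϖ₀)|]` of `ℚˣ/Nm(ℚ(√−2)ˣ)` (`2048 ∈ 2·(ℚˣ)²`, `2 ∈ Nm`).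
research route conditional on HC_CM; not a corollary; Q11.4-sentence-2 already refuted in dim ≥ 3. [cite: vanGeemen1994HodgeAV, Lemma 5.2 (3)–(4) and (5.4.1)] [cite: Shimura1998, §14.3 Prop. 4–5, pp. 103–104] -/
theorem det_realPart_type_span_pos_sqrtNegTwo [IsCyclotomicExtension {32} ℚ K] [IsCMField K] (hζ : IsPrimitiveRoot ζ 32)
    (Φ : CMType K)
    (hneg : (Finset.univ.filter fun φ : Φ.1 => (φ.1 (ζ ^ 4 + ζ ^ 12)).im < 0).card = 4)
    (hposc : (Finset.univ.filter fun φ : Φ.1 => 0 < (φ.1 (ζ ^ 4 + ζ ^ 12)).im).card = 4)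
    {ϖ₀ : 𝓞 (maximalRealSubfield K)} (hϖ0 : ϖ₀ ≠ 0)
    {ζ' : K} (hζ' : IsCMField.complexConj K ζ' = -ζ') (hpos : ∀ φ : Φ.1, 0 < (φ.1 ζ').im)
    (hT : CMTypeLattice.IsOfType (1 : (FractionalIdeal (𝓞 K)⁰ K)ˣ) ζ' (Ideal.span {ϖ₀}))
    {x : Fin 8 → K} (hx : ∀ i, x i = (ζ + ζ⁻¹) ^ (i : ℕ)) {a : Matrix (Fin 8) (Fin 8) ℚ}
    (ha : ∀ i j, a i j = Algebra.trace ℚ K (ζ' * x i * IsCMField.complexConj K ((ζ ^ 4 + ζ ^ 12) * x j))) :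
    a.det = |Algebra.norm ℚ ((ϖ₀ : maximalRealSubfield K))| * 2048 := by
  obtain ⟨ωb, hωb⟩ := exists_basis_thetaPow hζ
  have hx' : ∀ i, x i = (ωb i : K) := fun i => (hx i).trans (hωb i).symm
  have hs := complexConj_sqrtNegTwo hζ
  have hs0 : ((ζ ^ 4 + ζ ^ 12) : K) ≠ 0 := fun h => by
    have h2 := sq_sqrtNegTwo hζ
    rw [h] at h2
    norm_num at h2
  have hζ'0 : ζ' ≠ 0 := by
    obtain ⟨φ, -⟩ := Finset.card_pos.mp (by rw [hposc]; norm_num :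
      0 < (Finset.univ.filter fun φ : Φ.1 => 0 < (φ.1 (ζ ^ 4 + ζ ^ 12)).im).card)
    intro h0
    have := hpos φ
    rw [h0, map_zero, Complex.zero_im] at this
    exact lt_irrefl _ this
  obtain ⟨γ₀, hγ⟩ := exists_real_eq_mul_of_skew hζ' hs
  have hsign := neg_one_pow_mul_det_realPart_pos Φ ωb hζ' hs hs0 hζ'0 hpos hneg hposc hx' hγ ha
  have hD0 : (0 : ℚ) < 2048 := by norm_num
  rcases det_realPart_type_span_sqrtNegTwo_or hζ ϖ₀ hϖ0 hζ' hT hx ha with h | h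
  · rw [h] at hsign ⊢
    have hN : 0 < Algebra.norm ℚ ((ϖ₀ : maximalRealSubfield K)) := by
      by_contra hle
      push Not at hle
      norm_num at hsign
      nlinarith [hsign, hle, hD0]
    rw [abs_of_pos hN]
  · rw [h] at hsign ⊢
    have hN : Algebra.norm ℚ ((ϖ₀ : maximalRealSubfield K)) < 0 := by
      by_contra hle
      push Not at hle
      norm_num at hsign
      nlinarith [hsign, hle, hD0]
    rw [abs_of_neg hN]
    ring

open scoped Classical in
/-- **CENSUS FORM OF THE LAW at `32`** (`K_d = ℚ(√−2)`): for EVERY real integer `ϖ₀ ≠ 0` of `ℚ(ζ_32)⁺` — either norm sign — and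
every CM type `Φ` of `s₂`-signature `(4,4)`, `ℂ^Φ/Φ(ℤ[ζ_32])` CARRIES a `Φ`-positive divisor of type `(K; Φ; (ϖ₀))` (part 61
`exists_type_span_thirtyTwo`, no balance hypothesis needed) and EVERY such divisor has Gram determinant `|N(ϖ₀)|·2048`:
**every `|N(ϖ₀)|`, `ϖ₀ ∈ ℤ[ζ₃₂]⁺ ∖ 0`, is the component of a `ℤ[ζ₃₂]`-CM point of Weil type.**
research route conditional on HC_CM; not a corollary; Q11.4-sentence-2 already refuted in dim ≥ 3. [cite: vanGeemen1994HodgeAV, Lemma 5.2 (3)–(4) and (5.4.1)] [cite: Shimura1998, §14.3 Prop. 4–5, pp. 103–104] -/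
theorem exists_type_span_sqrtNegTwo_det [IsCyclotomicExtension {32} ℚ K] [IsCMField K] (hζ : IsPrimitiveRoot ζ 32)
    (Φ : CMType K)
    (hneg : (Finset.univ.filter fun φ : Φ.1 => (φ.1 (ζ ^ 4 + ζ ^ 12)).im < 0).card = 4)
    (hposc : (Finset.univ.filter fun φ : Φ.1 => 0 < (φ.1 (ζ ^ 4 + ζ ^ 12)).im).card = 4)
    (ϖ₀ : 𝓞 (maximalRealSubfield K)) (hϖ0 : ϖ₀ ≠ 0) :
    ∃ ζ' : K, IsCMField.complexConj K ζ' = -ζ' ∧ (∀ φ : Φ.1, 0 < (φ.1 ζ').im) ∧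
      CMTypeLattice.IsOfType (1 : (FractionalIdeal (𝓞 K)⁰ K)ˣ) ζ' (Ideal.span {ϖ₀}) ∧
      ∀ (x : Fin 8 → K), (∀ i, x i = (ζ + ζ⁻¹) ^ (i : ℕ)) → ∀ a : Matrix (Fin 8) (Fin 8) ℚ,
        (∀ i j, a i j = Algebra.trace ℚ K (ζ' * x i * IsCMField.complexConj K ((ζ ^ 4 + ζ ^ 12) * x j))) →
        a.det = |Algebra.norm ℚ ((ϖ₀ : maximalRealSubfield K))| * 2048 := by
  obtain ⟨ζ', h1, h2, h3⟩ := exists_type_span_thirtyTwo hζ Φ hϖ0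
  exact ⟨ζ', h1, h2, h3, fun x hx a ha => det_realPart_type_span_pos_sqrtNegTwo hζ Φ hneg hposc hϖ0 h1 h2 h3 hx ha⟩

/-- **`[N·2048] = [N]` in `ℚˣ/Nm(ℚ(√−2)ˣ)`** for every rational `N ≠ 0` (`1/2048 = 0² + 2·(1 / 64)²`: `2048 = 2⁷·2⁴ ∈ 2·(ℚˣ)²` and `2` is a norm
from `ℚ(√−2)`): the class of a type-`(ϖ₀)` point at `32` is `[|N_{K⁺/ℚ}(ϖ₀)|]`.
research route conditional on HC_CM; not a corollary; Q11.4-sentence-2 already refuted in dim ≥ 3. [cite: vanGeemen1994HodgeAV, 5.4 and (5.4.1)] -/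
theorem mk_mul_det_xi_sqrtNegTwo (N : ℚ) (hN : N ≠ 0) :
    (QuotientGroup.mk (Units.mk0 (N * 2048) (mul_ne_zero hN (by norm_num))) : weilNormResidueGroup 2) =
      QuotientGroup.mk (Units.mk0 N hN) := by
  rw [QuotientGroup.eq]
  have e : (Units.mk0 (N * 2048) (mul_ne_zero hN (by norm_num)))⁻¹ * Units.mk0 N hN =
      Units.mk0 ((1 / 2048 : ℚ)) (by norm_num) := by
    ext
    simp only [Units.val_mul, Units.val_inv_eq_inv_val, Units.val_mk0]
    field_simp
  rw [e]
  exact mem_normUnitsSubgroup_of_sq_add_mul_sq _ (0 : ℚ) ((1 / 64) : ℚ) (by norm_num)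

end Summit.HodgeConjecture.Ring2WeilCoverage.WeilGramLevel32TypeLaw

end
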